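import Summits.QuantumFields.YangMills.Theorems.LuscherReductionTwistedTraceScalingFloorNormalisationBudget
import HarnessLib

/-!
# The NORMALISATION COMPARISON `N_B·e^{−6Z₀} ≤ Λ_id·e^{o(β^{−p})}` and ★★★★★ COARSE-UPPER(L) ⇐ INNER one-orbit ALONE
# (lane A of S-BASE, crux `TwistedTraceScaling` stmt-QuantumFields-20203; design note `pub/ym-fleet/ym-luscher-20007-p1/COARSE-DESIGN.md` §17.7, §19)

After `…FloorAssembly` the valley side of COARSE-UPPER(L) needs, besides `InnerNoIntruderOneOrbitAt`, only the comparison of lane B's explicit UPPER normalisation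
`N_B = riccatiN L β (β^{−r}) (2β^{−q}) (β^{−m}) = riccatiPref · riccatiGauss` (`…ValleyBOUpper`) with the ideal level `Λ_id` (`…FloorAssembly`):
`N_B e^{−6Z₀}/Λ_id = e^{(β/2)(stepErrLo + chartErr)} · e^{trialErr} · (1+ρ²)^{3|E|} · e^{3|E|·modeZPE(μ(1+ρ²)²/2)}` (budgets in `…FloorNormalisationBudget`).
* §1 ★★★ `riccatiN_idealCmp_pow` — for `0 < p`, `p < m/2`, `2r < q`, `1 + 3m − 3r < −p`, `0 ≤ m`: `∀ ε > 0`, eventually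
  `riccatiN L β (β^{−r}) (2β^{−q}) (β^{−m})·e^{−6Z₀(1/2)} ≤ Λ_id(β)·e^{εβ^{−p}}` — the exponents are `3|E|β^{−2r}`, `3|E|√2β^{−m/2}`, `Kβ^{1−3r}`, `Kβ^{1+3m−3r}` (weight Lipschitz
  constant `≲ β^{1+3m}` × chart data `ρ³`; `ghat_le` of `…ValleyBOUpperPow`);
* §2 ★★★★★ `coarseNoIntruderAt_of_inner_pow` — for `L ≥ 2`, `0 < p < 1/10`, `4p < q < 8/9`, `0 < r < 1/2`, `0 < m`, `2r < q − m/2`, `p < m/2`, `1 + 3m − 3r < −p`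
  (e.g. `(p,q,r,m) = (1/40, 17/20, 41/100, 11/200)`, `innerPow_window_nonempty`): **COARSE-UPPER(L) ⇐ `InnerNoIntruderOneOrbitAt L (β^{−p})` ALONE** — the VALLEY
  (C3: GEOM g9, UPPER g9 + lane B, k = 0 FLOOR g10, normalisation g10) is kernel-checked end to end.
HONEST FRAMING: real asymptotics + bookkeeping for a stub lane of a child of the CONDITIONAL reduction route (femto rung R2b1); INNER one-orbit (C4) is OPEN; COARSE-UPPER
itself is one of three inputs of S-BASE (with COARSE-LOWER, COARSE-TAIL); not infinite volume, not a gap, not Clay.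

## References
* M. Lüscher, Nucl. Phys. B219 (1983) 233, §3. [Luscher1983]
* M. Lüscher, G. Münster, Nucl. Phys. B232 (1984) 445, §2. [LuscherMunster1984]
* A. Wipf, LNP 992 (2021), §8.5. [Wipf2021]
-/

set_option autoImplicit false

noncomputable section

open MeasureTheory Real Finset
open scoped BigOperators
open Literature.MathematicalPhysics.QuantumFieldTheory
open Literature.MathematicalPhysics.QuantumLattice

namespace Summit.QuantumFields.YangMills.Theorems.FemtoTransferGap

open TwoLattice TwoLattice.Toron TwoLattice.Cov TwoLattice.Stiff TwoLattice.Harm TwoLattice.GnChart TwoLattice.Flat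

variable {L : ℕ} [NeZero L]

/-! ## §1 ★★★ The normalisation comparison at polynomial scales -/

set_option maxHeartbeats 800000 in
/-- ★★★ **THE NORMALISATION COMPARISON**: for `0 < p`, `p < m/2`, `2r < q`, `1 + 3m − 3r < −p`, `0 ≤ m` (so `p < 2r`): for every `ε > 0`, eventually
`riccatiN L β (β^{−r}) (2β^{−q}) (β^{−m}) · e^{−6·toronZPE L (1/2) 0 0} ≤ Λ_id(β) · e^{ε β^{−p}}` (a long but elementary bookkeeping proof; heartbeats raised).
[cite: Luscher1983, §3] [cite: Wipf2021, §8.5.2] -/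
theorem riccatiN_idealCmp_pow {p q r m : ℝ} (hp : 0 < p) (hpm : p < m / 2) (hrq : 2 * r < q) (hC : 1 + 3 * m - 3 * r < -p)
    (hm : 0 ≤ m) :
    ∀ ε : ℝ, 0 < ε → ∃ β0 : ℝ, ∀ β : ℝ, β0 ≤ β →
      riccatiN L β (powScale r β) (2 * powScale q β) (powScale m β) * Real.exp (-(6 * toronZPE L (1 / 2) 0 0)) ≤
        idealFloorLevel L β * Real.exp (ε * powScale p β) := by
  intro ε hε
  set N : ℝ := (Fintype.card (Plaquette 3 L × Fin 3) : ℝ) with hN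
  set n : ℝ := (Fintype.card (Edge 3 L × Fin 3) : ℝ) with hn
  set n3 : ℕ := Fintype.card (Edge 3 L) * 3 with hn3
  have hsN : 0 ≤ Real.sqrt N := Real.sqrt_nonneg _
  have hsn : 0 ≤ Real.sqrt n := Real.sqrt_nonneg _
  have hs2 : 0 ≤ Real.sqrt 2 := Real.sqrt_nonneg _
  -- constants
  set C₂ : ℝ := Real.sqrt 2 + 10 * Real.sqrt N with hC₂
  set Cd : ℝ := Real.sqrt N * (720 + 66 * Real.sqrt 2) + 5 * Real.sqrt N with hCd
  set KS : ℝ := C₂ * (Real.sqrt N * (720 + 66 * Real.sqrt 2)) + 5 * Real.sqrt N * C₂ with hKS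
  set KT : ℝ := 504 * Real.sqrt N * (20 * Real.sqrt N) * (5 * Real.sqrt n * (10 * Real.sqrt N) ^ 2 + 2) * (C₂ + Cd) ^ 2 + 2 * Cd * ((C₂ + Cd) + C₂) with hKT
  have hC₂0 : 0 ≤ C₂ := by positivity
  have hCd0 : 0 ≤ Cd := by positivity
  have hKS0 : 0 ≤ KS := by positivity
  have hKT0 : 0 ≤ KT := by positivity
  -- four thresholds
  obtain ⟨β1, h1⟩ := eventually_const_rpow_le (K := (n3 : ℝ)) (a := 2 * r) (p := p) (ε := ε / 4) (by linarith) (by positivity)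
  obtain ⟨β2, h2⟩ := eventually_const_rpow_le (K := (n3 : ℝ) * Real.sqrt 2) (a := m / 2) (p := p) (ε := ε / 4) (by linarith) (by positivity)
  obtain ⟨β3, h3⟩ := eventually_const_rpow_le (K := KS) (a := 3 * r - 1) (p := p) (ε := ε / 4) (by linarith) (by positivity)
  obtain ⟨β4, h4⟩ := eventually_const_rpow_le (K := KT) (a := 3 * r - 3 * m - 1) (p := p) (ε := ε / 4) (by linarith) (by positivity)
  refine ⟨max β1 (max β2 (max β3 β4)), fun β hβ => ?_⟩
  obtain ⟨hβ1, hb1⟩ := h1 β ((le_max_left _ _).trans hβ)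
  obtain ⟨-, hb2⟩ := h2 β (((le_max_left _ _).trans (le_max_right _ _)).trans hβ)
  obtain ⟨-, hb3⟩ := h3 β ((((le_max_left _ _).trans (le_max_right _ _)).trans (le_max_right _ _)).trans hβ)
  obtain ⟨-, hb4⟩ := h4 β ((((le_max_right _ _).trans (le_max_right _ _)).trans (le_max_right _ _)).trans hβ)
  have hβ0 : 0 < β := lt_of_lt_of_le one_pos hβ1
  -- the scales
  have hps : ∀ a : ℝ, powScale a β = β ^ (-a) := fun a => by rw [powScale, max_eq_left hβ1]
  rw [hps, hps, hps, hps]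
  have hρ0 : 0 ≤ β ^ (-r) := (Real.rpow_pos_of_pos hβ0 _).le
  have hρ1 : β ^ (-r) ≤ 1 := Real.rpow_le_one_of_one_le_of_nonpos hβ1 (by linarith)
  have hμ0 : 0 < β ^ (-m) := Real.rpow_pos_of_pos hβ0 _
  have hsσ : Real.sqrt (2 * β ^ (-q)) ≤ Real.sqrt 2 * β ^ (-r) := by
    rw [Real.sqrt_mul' _ (Real.rpow_pos_of_pos hβ0 _).le]
    refine mul_le_mul_of_nonneg_left ?_ hs2
    rw [Real.sqrt_eq_rpow, ← Real.rpow_mul hβ0.le]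
    exact Real.rpow_le_rpow_of_exponent_le hβ1 (by linarith)
  -- monomials
  have hρ3 : (β ^ (-r)) ^ 3 = β ^ (-r * 3) := by rw [← Real.rpow_natCast, ← Real.rpow_mul hβ0.le]; norm_num
  have hM1 : β * (β ^ (-r)) ^ 3 = β ^ (-(3 * r - 1)) := by
    rw [hρ3]
    have h1 : β * β ^ (-r * 3) = β ^ (1 : ℝ) * β ^ (-r * 3) := by rw [Real.rpow_one]
    rw [h1, ← Real.rpow_add hβ0]
    rw [show (1 : ℝ) + -r * 3 = -(3 * r - 1) by ring]
  have hM2 : β ^ (1 + 3 * m) * (β ^ (-r)) ^ 3 = β ^ (-(3 * r - 3 * m - 1)) := by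
    rw [hρ3, ← Real.rpow_add hβ0]
    rw [show (1 : ℝ) + 3 * m + -r * 3 = -(3 * r - 3 * m - 1) by ring]
  have hM3 : (β ^ (-r)) ^ 2 = β ^ (-(2 * r)) := by
    rw [← Real.rpow_natCast, ← Real.rpow_mul hβ0.le]
    rw [show -r * ((2 : ℕ) : ℝ) = -(2 * r) by push_cast; ring]
  have hM4 : Real.sqrt (2 * β ^ (-m)) = Real.sqrt 2 * β ^ (-(m / 2)) := by
    rw [Real.sqrt_mul' _ hμ0.le, Real.sqrt_eq_rpow (β ^ (-m)), ← Real.rpow_mul hβ0.le]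
    rw [show -m * (1 / (2 : ℝ)) = -(m / 2) by ring]
  -- the weight constants: `ĝ' ≤ 2β^{1+m/2} ≤ 2β^{1+3m}`, `ĝ'/μ ≤ 2β^{1+3m}`, `Lip ≤ 5β^{1+3m}`
  have hĝ := ghat_le (ρ := β ^ (-r)) hβ1 hm
  have hĝ0 : 0 ≤ Real.sqrt ((β / 2) ^ 2 + 2 * (β / 2) * (β / (1 + (β ^ (-r)) ^ 2) ^ 2) / β ^ (-m)) := Real.sqrt_nonneg _
  have hW : β ^ (1 + m / 2) ≤ β ^ (1 + 3 * m) := Real.rpow_le_rpow_of_exponent_le hβ1 (by linarith)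
  have hW0 : 0 < β ^ (1 + 3 * m) := Real.rpow_pos_of_pos hβ0 _
  have hm₁ : Real.sqrt ((β / 2) ^ 2 + 2 * (β / 2) * (β / (1 + (β ^ (-r)) ^ 2) ^ 2) / β ^ (-m)) ≤ 2 * β ^ (1 + 3 * m) :=
    hĝ.trans (by linarith only [hW])
  have hmw : Real.sqrt ((β / 2) ^ 2 + 2 * (β / 2) * (β / (1 + (β ^ (-r)) ^ 2) ^ 2) / β ^ (-m)) / β ^ (-m) ≤ 2 * β ^ (1 + 3 * m) := by
    rw [div_le_iff₀ hμ0]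
    have h5 : β ^ (1 + 3 * m) * β ^ (-m) = β ^ (1 + 2 * m) := by
      rw [← Real.rpow_add hβ0, show 1 + 3 * m + -m = 1 + 2 * m by ring]
    have h6 : β ^ (1 + m / 2) ≤ β ^ (1 + 2 * m) := Real.rpow_le_rpow_of_exponent_le hβ1 (by linarith)
    calc _ ≤ 2 * β ^ (1 + m / 2) := hĝ
      _ ≤ 2 * β ^ (1 + 2 * m) := by linarith only [h6]
      _ = 2 * β ^ (1 + 3 * m) * β ^ (-m) := by rw [mul_assoc, h5]
  have hLip : 3 * (β / 2) / (β ^ (-m)) ^ 2 + 3 * (β / (1 + (β ^ (-r)) ^ 2) ^ 2) / (β ^ (-m)) ^ 3 ≤ 5 * β ^ (1 + 3 * m) := by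
    have hb' : β / (1 + (β ^ (-r)) ^ 2) ^ 2 ≤ β := div_le_self hβ0.le (one_le_pow₀ (by linarith only [sq_nonneg (β ^ (-r))]))
    have e2 : (β ^ (-m)) ^ 2 = (β ^ (2 * m))⁻¹ := by
      rw [← Real.rpow_natCast, ← Real.rpow_mul hβ0.le, ← Real.rpow_neg hβ0.le]; congr 1; push_cast; ring
    have e3 : (β ^ (-m)) ^ 3 = (β ^ (3 * m))⁻¹ := by
      rw [← Real.rpow_natCast, ← Real.rpow_mul hβ0.le, ← Real.rpow_neg hβ0.le]; congr 1; push_cast; ring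
    rw [e2, e3, div_inv_eq_mul, div_inv_eq_mul]
    have h7 : β * β ^ (2 * m) ≤ β ^ (1 + 3 * m) := by
      nth_rw 1 [← Real.rpow_one β]; rw [← Real.rpow_add hβ0]; exact Real.rpow_le_rpow_of_exponent_le hβ1 (by linarith)
    have h8 : β * β ^ (3 * m) = β ^ (1 + 3 * m) := by nth_rw 1 [← Real.rpow_one β]; rw [← Real.rpow_add hβ0]
    have h9 : β / (1 + (β ^ (-r)) ^ 2) ^ 2 * β ^ (3 * m) ≤ β * β ^ (3 * m) := mul_le_mul_of_nonneg_right hb' (Real.rpow_pos_of_pos hβ0 _).le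
    have h10 : 3 * (β / 2) * β ^ (2 * m) = 3 / 2 * (β * β ^ (2 * m)) := by ring
    have h11 : 3 * (β / (1 + (β ^ (-r)) ^ 2) ^ 2) * β ^ (3 * m) = 3 * (β / (1 + (β ^ (-r)) ^ 2) ^ 2 * β ^ (3 * m)) := by ring
    rw [h10, h11]
    linarith only [h7, h8, h9, hW0]
  -- ### the four exponents
  -- (a) lane B's action errors
  have hS : β / 2 * (stepErrLo (β ^ (-r)) (2 * β ^ (-q)) N + chartErr (β ^ (-r)) (2 * β ^ (-q)) N) ≤ ε / 4 * β ^ (-p) := by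
    have h := stepErr_rho_le (N := N) hβ0.le hρ0 hρ1 hsσ
    rw [hM1, ← hC₂, ← hKS] at h
    exact h.trans hb3
  -- (b) the trial-exponent error
  have hE : trialErr (β ^ (-r)) (2 * β ^ (-q)) N n
      (Real.sqrt ((β / 2) ^ 2 + 2 * (β / 2) * (β / (1 + (β ^ (-r)) ^ 2) ^ 2) / β ^ (-m)) / β ^ (-m))
      (Real.sqrt ((β / 2) ^ 2 + 2 * (β / 2) * (β / (1 + (β ^ (-r)) ^ 2) ^ 2) / β ^ (-m)))
      (3 * (β / 2) / (β ^ (-m)) ^ 2 + 3 * (β / (1 + (β ^ (-r)) ^ 2) ^ 2) / (β ^ (-m)) ^ 3) ≤ ε / 4 * β ^ (-p) := by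
    have h := trialErr_rho_le (N := N) (n := n)
      (mw := Real.sqrt ((β / 2) ^ 2 + 2 * (β / 2) * (β / (1 + (β ^ (-r)) ^ 2) ^ 2) / β ^ (-m)) / β ^ (-m))
      (Lg := 3 * (β / 2) / (β ^ (-m)) ^ 2 + 3 * (β / (1 + (β ^ (-r)) ^ 2) ^ 2) / (β ^ (-m)) ^ 3)
      hρ0 hρ1 hsσ (by positivity) hĝ0 (by positivity)
    refine h.trans (le_trans ?_ hb4)
    rw [← hM2]
    -- the bracket is `≤ KT · β^{1+3m}`
    have h5 : 504 * Real.sqrt N * (20 * Real.sqrt N) *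
          ((3 * (β / 2) / (β ^ (-m)) ^ 2 + 3 * (β / (1 + (β ^ (-r)) ^ 2) ^ 2) / (β ^ (-m)) ^ 3) * Real.sqrt n * (10 * Real.sqrt N) ^ 2 +
            Real.sqrt ((β / 2) ^ 2 + 2 * (β / 2) * (β / (1 + (β ^ (-r)) ^ 2) ^ 2) / β ^ (-m)) / β ^ (-m)) * (C₂ + Cd) ^ 2 +
          Real.sqrt ((β / 2) ^ 2 + 2 * (β / 2) * (β / (1 + (β ^ (-r)) ^ 2) ^ 2) / β ^ (-m)) * Cd * ((C₂ + Cd) + C₂) ≤ KT * β ^ (1 + 3 * m) := by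
      have h6 : (3 * (β / 2) / (β ^ (-m)) ^ 2 + 3 * (β / (1 + (β ^ (-r)) ^ 2) ^ 2) / (β ^ (-m)) ^ 3) * Real.sqrt n * (10 * Real.sqrt N) ^ 2 +
          Real.sqrt ((β / 2) ^ 2 + 2 * (β / 2) * (β / (1 + (β ^ (-r)) ^ 2) ^ 2) / β ^ (-m)) / β ^ (-m) ≤
          (5 * Real.sqrt n * (10 * Real.sqrt N) ^ 2 + 2) * β ^ (1 + 3 * m) := by
        have := mul_le_mul_of_nonneg_right (mul_le_mul_of_nonneg_right hLip hsn) (sq_nonneg (10 * Real.sqrt N))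
        have e1 : 5 * β ^ (1 + 3 * m) * Real.sqrt n * (10 * Real.sqrt N) ^ 2 = (5 * Real.sqrt n * (10 * Real.sqrt N) ^ 2) * β ^ (1 + 3 * m) := by ring
        rw [e1] at this
        have e2 : (5 * Real.sqrt n * (10 * Real.sqrt N) ^ 2 + 2) * β ^ (1 + 3 * m) =
            (5 * Real.sqrt n * (10 * Real.sqrt N) ^ 2) * β ^ (1 + 3 * m) + 2 * β ^ (1 + 3 * m) := by ring
        rw [e2]
        exact add_le_add this hmw
      have h7 := mul_le_mul_of_nonneg_left h6 (show 0 ≤ 504 * Real.sqrt N * (20 * Real.sqrt N) by positivity)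
      have h8 := mul_le_mul_of_nonneg_right h7 (sq_nonneg (C₂ + Cd))
      have h9 := mul_le_mul_of_nonneg_right (mul_le_mul_of_nonneg_right hm₁ hCd0) (show 0 ≤ (C₂ + Cd) + C₂ by positivity)
      have e3 : KT * β ^ (1 + 3 * m) = 504 * Real.sqrt N * (20 * Real.sqrt N) * ((5 * Real.sqrt n * (10 * Real.sqrt N) ^ 2 + 2) * β ^ (1 + 3 * m)) * (C₂ + Cd) ^ 2 +
          2 * β ^ (1 + 3 * m) * Cd * ((C₂ + Cd) + C₂) := by rw [hKT]; ring
      rw [e3]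
      exact add_le_add h8 h9
    rw [hC₂, hCd] at h5
    exact (mul_le_mul_of_nonneg_right h5 (pow_nonneg hρ0 3)).trans_eq (mul_assoc _ _ _)
  -- (c) the Gaussian factor
  have hG := riccatiGauss_le (L := L) (μ := β ^ (-m)) hβ0 hρ0 hρ1 hμ0.le
  rw [hM3, hM4, ← hn3] at hG
  have hc : (n3 : ℝ) * β ^ (-(2 * r)) ≤ ε / 4 * β ^ (-p) := hb1
  have hd : (n3 : ℝ) * (Real.sqrt 2 * β ^ (-(m / 2))) ≤ ε / 4 * β ^ (-p) := by rw [← mul_assoc]; exact hb2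
  -- ### assemble
  rw [riccatiN, riccatiPref, idealFloorLevel, ← hN, ← hn, ← hn3]
  have hQ : 0 < Real.sqrt (Real.pi / β) ^ n3 := pow_pos (Real.sqrt_pos.2 (by positivity)) _
  have hpre : 0 < ((2 * π ^ 2)⁻¹) ^ Fintype.card (Edge 3 L) * Real.exp (2 * β) ^ Fintype.card (Edge 3 L) := by positivity
  have hexp : Real.exp (β / 2 * (stepErrLo (β ^ (-r)) (2 * β ^ (-q)) N + chartErr (β ^ (-r)) (2 * β ^ (-q)) N)) *
      Real.exp (trialErr (β ^ (-r)) (2 * β ^ (-q)) N n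
        (Real.sqrt ((β / 2) ^ 2 + 2 * (β / 2) * (β / (1 + (β ^ (-r)) ^ 2) ^ 2) / β ^ (-m)) / β ^ (-m))
        (Real.sqrt ((β / 2) ^ 2 + 2 * (β / 2) * (β / (1 + (β ^ (-r)) ^ 2) ^ 2) / β ^ (-m)))
        (3 * (β / 2) / (β ^ (-m)) ^ 2 + 3 * (β / (1 + (β ^ (-r)) ^ 2) ^ 2) / (β ^ (-m)) ^ 3)) *
      (Real.exp ((n3 : ℝ) * β ^ (-(2 * r))) * Real.exp ((n3 : ℝ) * (Real.sqrt 2 * β ^ (-(m / 2))))) ≤ Real.exp (ε * β ^ (-p)) := by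
    rw [← Real.exp_add, ← Real.exp_add, ← Real.exp_add, Real.exp_le_exp]
    linarith only [hS, hE, hc, hd]
  calc ((2 * π ^ 2)⁻¹) ^ Fintype.card (Edge 3 L) * Real.exp (2 * β) ^ Fintype.card (Edge 3 L) *
        Real.exp (β / 2 * (stepErrLo (β ^ (-r)) (2 * β ^ (-q)) N + chartErr (β ^ (-r)) (2 * β ^ (-q)) N)) *
        Real.exp (trialErr (β ^ (-r)) (2 * β ^ (-q)) N n
          (Real.sqrt ((β / 2) ^ 2 + 2 * (β / 2) * (β / (1 + (β ^ (-r)) ^ 2) ^ 2) / β ^ (-m)) / β ^ (-m))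
          (Real.sqrt ((β / 2) ^ 2 + 2 * (β / 2) * (β / (1 + (β ^ (-r)) ^ 2) ^ 2) / β ^ (-m)))
          (3 * (β / 2) / (β ^ (-m)) ^ 2 + 3 * (β / (1 + (β ^ (-r)) ^ 2) ^ 2) / (β ^ (-m)) ^ 3)) *
        riccatiGauss L β (β ^ (-r)) (β ^ (-m)) * Real.exp (-(6 * toronZPE L (1 / 2) 0 0))
      ≤ ((2 * π ^ 2)⁻¹) ^ Fintype.card (Edge 3 L) * Real.exp (2 * β) ^ Fintype.card (Edge 3 L) *
        Real.exp (β / 2 * (stepErrLo (β ^ (-r)) (2 * β ^ (-q)) N + chartErr (β ^ (-r)) (2 * β ^ (-q)) N)) *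
        Real.exp (trialErr (β ^ (-r)) (2 * β ^ (-q)) N n
          (Real.sqrt ((β / 2) ^ 2 + 2 * (β / 2) * (β / (1 + (β ^ (-r)) ^ 2) ^ 2) / β ^ (-m)) / β ^ (-m))
          (Real.sqrt ((β / 2) ^ 2 + 2 * (β / 2) * (β / (1 + (β ^ (-r)) ^ 2) ^ 2) / β ^ (-m)))
          (3 * (β / 2) / (β ^ (-m)) ^ 2 + 3 * (β / (1 + (β ^ (-r)) ^ 2) ^ 2) / (β ^ (-m)) ^ 3)) *
        (Real.sqrt (Real.pi / β) ^ n3 * Real.exp ((n3 : ℝ) * β ^ (-(2 * r))) * Real.exp ((n3 : ℝ) * (Real.sqrt 2 * β ^ (-(m / 2))))) *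
        Real.exp (-(6 * toronZPE L (1 / 2) 0 0)) :=
        mul_le_mul_of_nonneg_right (mul_le_mul_of_nonneg_left hG (by positivity)) (Real.exp_pos _).le
    _ = ((2 * π ^ 2)⁻¹) ^ Fintype.card (Edge 3 L) * Real.exp (2 * β) ^ Fintype.card (Edge 3 L) *
        (Real.sqrt (Real.pi / β) ^ n3 * Real.exp (-(6 * toronZPE L (1 / 2) 0 0))) *
        (Real.exp (β / 2 * (stepErrLo (β ^ (-r)) (2 * β ^ (-q)) N + chartErr (β ^ (-r)) (2 * β ^ (-q)) N)) *
          Real.exp (trialErr (β ^ (-r)) (2 * β ^ (-q)) N n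
            (Real.sqrt ((β / 2) ^ 2 + 2 * (β / 2) * (β / (1 + (β ^ (-r)) ^ 2) ^ 2) / β ^ (-m)) / β ^ (-m))
            (Real.sqrt ((β / 2) ^ 2 + 2 * (β / 2) * (β / (1 + (β ^ (-r)) ^ 2) ^ 2) / β ^ (-m)))
            (3 * (β / 2) / (β ^ (-m)) ^ 2 + 3 * (β / (1 + (β ^ (-r)) ^ 2) ^ 2) / (β ^ (-m)) ^ 3)) *
          (Real.exp ((n3 : ℝ) * β ^ (-(2 * r))) * Real.exp ((n3 : ℝ) * (Real.sqrt 2 * β ^ (-(m / 2)))))) := by ring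
    _ ≤ ((2 * π ^ 2)⁻¹) ^ Fintype.card (Edge 3 L) * Real.exp (2 * β) ^ Fintype.card (Edge 3 L) *
        (Real.sqrt (Real.pi / β) ^ n3 * Real.exp (-(6 * toronZPE L (1 / 2) 0 0))) * Real.exp (ε * β ^ (-p)) :=
        mul_le_mul_of_nonneg_left hexp (by positivity)

/-! ## §2 ★★★★★ COARSE-UPPER(L) from the one-orbit INNER NO-INTRUDER alone -/

/-- ★★★★★ **COARSE-UPPER(L) ⇐ INNER ONE-ORBIT.**  For `L ≥ 2` and exponents `0 < p < 1/10`, `4p < q < 8/9`, `0 < r`, `2r < 1`, `0 < m`, `2r < q − m/2`, `p < m/2`,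
`1 + 3m − 3r < −p` (e.g. `(p, q, r, m) = (1/40, 17/20, 41/100, 11/200)`): `InnerNoIntruderOneOrbitAt L (β^{−p})` implies COARSE-UPPER(L) — the VALLEY contribution
(geometry, UPPER, k = 0 FLOOR, normalisation) is discharged. [cite: Luscher1983, §3] [cite: LuscherMunster1984, §2] -/
theorem coarseNoIntruderAt_of_inner_pow (hL : 2 ≤ L) {p q r m : ℝ} (hp0 : 0 < p) (hp : p < 1 / 10) (hpq : 4 * p < q) (hq : q < 8 / 9)
    (hr : 0 < r) (hr1 : 2 * r < 1) (hm : 0 < m) (hrq : 2 * r < q - m / 2) (hpm : p < m / 2) (hC : 1 + 3 * m - 3 * r < -p)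
    (hI : InnerNoIntruderOneOrbitAt L (powScale p)) :
    ∀ k : ℕ, ∀ d : ℝ, d < levelGap k → ∃ lam0 : ℝ, 0 < lam0 ∧ ∀ lam : ℝ, 0 < lam → lam ≤ lam0 →
      ∀ β : ℝ, InFemtoWindow lam β L →
        levelValue su2Rep L β k ≤ Real.exp (-(d * luscherLambda β L) / L) * levelValue su2Rep L β 0 :=
  coarseNoIntruderAt_of_idealCmp_pow hL hp0 hp hpq hq hr hr1 hm hrq
    (riccatiN_idealCmp_pow (L := L) hp0 hpm (by linarith) hC hm.le) hI

/-- The exponent window is NON-EMPTY: `(p, q, r, m) = (1/40, 17/20, 41/100, 11/200)` satisfies every constraint of `coarseNoIntruderAt_of_inner_pow`. [folklore] -/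
theorem innerPow_window_nonempty :
    (0 : ℝ) < 1 / 40 ∧ (1 / 40 : ℝ) < 1 / 10 ∧ 4 * (1 / 40 : ℝ) < 17 / 20 ∧ (17 / 20 : ℝ) < 8 / 9 ∧ (0 : ℝ) < 41 / 100 ∧ 2 * (41 / 100 : ℝ) < 1 ∧
      (0 : ℝ) < 11 / 200 ∧ 2 * (41 / 100 : ℝ) < 17 / 20 - 11 / 200 / 2 ∧ (1 / 40 : ℝ) < 11 / 200 / 2 ∧ 1 + 3 * (11 / 200 : ℝ) - 3 * (41 / 100) < -(1 / 40) := by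
  norm_num

end Summit.QuantumFields.YangMills.Theorems.FemtoTransferGap

end
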